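import Summits.CriticalPhenomena.PercolationContinuityZ3.Theorems.FK.SamePContinuationC1
import Summits.CriticalPhenomena.PercolationContinuityZ3.Theorems.FK.InfiniteVolumeMeasures
import Summits.CriticalPhenomena.PercolationContinuityZ3.Theorems.FK.InfiniteVolumeDLR
import HarnessLib

/-!
# FK-continuity transplant, FO-11 (4): the continuation principle, unconditional — `FKContinuationPrinciple d q`
# and `FKContinuationZ3` for all `q ≥ 1`

Cell `fk-continuity` (bschramm), row FO-11 (C2); support file for the FK-continuity transplant
(`--supports stmt-CriticalPhenomena-4575`); builds on p205010 (kernel theorem, internal audit signed; external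
expert review pending).  No named facts, no sorries, standard axioms.

The existence input `hex` of `fkContinuationPrinciple_of_boxLimits` (file `SamePContinuationC1.lean`) — at every
density in `[0,1]` a FREE box limit satisfying the `FKGibbs` sandwich — is discharged by the cell's construction of the
free infinite-volume random-cluster measure `φ⁰_{p,q} = rcLimit d false p q` (row FO-06b, `isBoxLimit_rcLimit`,
Grimmett 2006 Thm. (4.19)(a)) and its DLR sandwich (row FO-06a-2, `IsBoxLimit.fkGibbs`, Lemma (4.13)/(4.14)(b)).  Hence
the cell's crux C2 (row FO-05's `FKContinuationPrinciple d q`: a sound FK history scheme robustly lawful at `(p, ε)`,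
`ε < 2⁻³²`, `0 < p < 1`, forces `p_c(q) < p`) holds for EVERY `q ≥ 1` and every `d`, and so does `FKContinuationZ3`.
What remains open in the cell is C3 (the construction of such a scheme from `θ⁰(p,q) > 0`: C3a = FH, and C3b = FT-07).

## References

* G. Kozma, S. Nitzan, arXiv:2401.12397 (2024), §1 p. 2 (approach 1), §4 p. 25. [KozmaNitzan2024]
* G. Grimmett, *The Random-Cluster Model*, Springer 2006: Thm (2.43), Lemma (4.13)/(4.14)(b), Thm (4.19)(a), (5.2).
  [Grimmett2006]
-/

noncomputable section

namespace Summit.CriticalPhenomena.PercolationContinuityZ3.Theorems.FK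

open MeasureTheory Literature.Probability.Percolation Literature.Probability.LatticeModels

variable {d : ℕ} {q : ℝ}

/-- At every density in `[0,1]` the free box limit `φ⁰_{p,q}` exists and satisfies the `FKGibbs` sandwich (`q ≥ 1`).
[cite: Grimmett2006, Thm. (4.19)(a); Lemma (4.13) and Lemma (4.14)(b)] -/
theorem exists_fkGibbs_and_isBoxLimit_false (hq : 1 ≤ q) (p' : ℝ) (hp' : p' ∈ Set.Icc (0 : ℝ) 1) :
    ∃ P : Measure (BondConfig (Site d)), FKGibbs d p' q P ∧ IsBoxLimit d false p' q P :=
  ⟨rcLimit d false p' q, (isBoxLimit_rcLimit false hp' hq).fkGibbs hp' hq, isBoxLimit_rcLimit false hp' hq⟩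

/-- **C2, unconditional: `FKContinuationPrinciple d q` for every `q ≥ 1`** — a sound FK history scheme robustly
lawful at `(p, ε)` with `ε < 2⁻³²` and `0 < p < 1` forces `p_c(q) < p` (Kozma–Nitzan's "approach 1" for the
random-cluster model: the pinned finite-volume laws are Lipschitz in `p`, the free infinite-volume measure obeys the
pinned domination, and a conditionally lawful exploration percolates). [cite: KozmaNitzan2024, §1 p. 2 (approach 1), §4 p. 25] -/
theorem fkContinuationPrinciple (hq : 1 ≤ q) : FKContinuationPrinciple d q :=
  fkContinuationPrinciple_of_boxLimits hq fun p' hp' => exists_fkGibbs_and_isBoxLimit_false hq p' hp'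

/-- **`FKContinuationZ3`**: the continuation principle on `ℤ³` for all `q ≥ 1`. [cite: KozmaNitzan2024, §1 p. 2 (approach 1)] -/
theorem fkContinuationZ3 : FKContinuationZ3 := fun _ hq => fkContinuationPrinciple hq

end Summit.CriticalPhenomena.PercolationContinuityZ3.Theorems.FK

end
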